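import Summits.RiemannHypothesis.RiemannHypothesis.Theorems.WeilCombCombShapePositivityFejerOfCrux
import Summits.RiemannHypothesis.RiemannHypothesis.Theorems.WeilCombCombShapeDetection
import Literature.NumberTheory.LFunctions.WeilCriterionConverse
import Literature.NumberTheory.LFunctions.LandauOscillation
import Mathlib

/-!
# Stub-ideation sketch — `stub_fejer` of crux `WeilComb.CombShapePositivity` (stmt-RiemannHypothesis-11229), ideator 1

FAMILY 1 (recognise & import). Statements of the proposed helper lemmas (sorried; statements only) and the
one-line EQUIVALENCE THEOREM `stub_fejer ⟺ RH` (kernel-checked from the tree). Companion of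
`STUB-IDEAS-stub_fejer-1.md` in the crux directory.

Notation: `φ₀(u) = expNegInvGlue (1 - u²)`, `φ_ε(t) = ε⁻¹ φ₀(t/ε)` (`bump ε`), `ψ_ε = φ_ε ⋆ φ̃_ε` (`autocorr ε`),
`w_ε(0) = W(ψ_ε)` (`diag ε`), `Φ₀(z) = (φ_1)^(1/2 + z) = ∫ φ₀(u) e^{zu} du`, `ψ₀ = φ₀ ⋆ φ₀` (`bumpK`),
`T_w(s) = ∫_{-2}^{2} ψ₀(t) e^{ε₀(wt - s)}/(s - wt) dt` (`cauchyT ε₀ w s`).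
-/

noncomputable section

set_option linter.dupNamespace false

open scoped BigOperators ComplexConjugate Real
open Complex MeasureTheory Set

namespace Summit.RiemannHypothesis.RiemannHypothesis.Theorems.WeilCombBohrFejer.StubFejerIdeas1

open Literature.NumberTheory.LFunctions
open Summit.RiemannHypothesis.RiemannHypothesis.Theses.WeilComb

/-- The route's bump at width `ε`: `φ_ε(t) = ε⁻¹ φ₀(t/ε)`. -/
def bump (ε : ℝ) : ℝ → ℂ := fun t : ℝ => (ε : ℂ)⁻¹ * ((expNegInvGlue (1 - (t / ε) ^ 2) : ℝ) : ℂ)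

/-- `ψ_ε = φ_ε ⋆ φ̃_ε`. -/
def autocorr (ε : ℝ) : ℝ → ℂ := weilConv (bump ε) (weilReflect (bump ε))

/-- The diagonal entry of every comb matrix: `w_ε(0) = W(ψ_ε)`. -/
def diag (ε : ℝ) : ℂ := weilFunctional (autocorr ε)

/-! ## H1 — the equivalence theorem to land (one line; both halves are in the tree) -/

/-- **`stub_fejer ⟺ RH`** (verbatim stub signature on the left). -/
theorem stub_fejer_iff_riemannHypothesis :
    (∀ ε : ℝ, 0 < ε → ∀ S : Finset ℕ, (∀ p ∈ S, p.Prime) → ∀ (n : ℕ) (θ : ℕ → ℝ),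
      0 ≤ (∑ d ∈ (∏ p ∈ S, p ^ n).divisors, ∑ d' ∈ (∏ p ∈ S, p ^ n).divisors,
        Complex.exp (I * ((∑ p ∈ S, θ p * (d.factorization p : ℝ) : ℝ) : ℂ)) *
          conj (Complex.exp (I * ((∑ p ∈ S, θ p * (d'.factorization p : ℝ) : ℝ) : ℂ))) *
          weilFunctional (weilTranslate
            (weilConv (fun t : ℝ => (ε : ℂ)⁻¹ * ((expNegInvGlue (1 - (t / ε) ^ 2) : ℝ) : ℂ))
              (weilReflect (fun t : ℝ => (ε : ℂ)⁻¹ * ((expNegInvGlue (1 - (t / ε) ^ 2) : ℝ) : ℂ))))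
            (Real.log (d : ℝ) - Real.log (d' : ℝ)))).re) ↔
      RiemannHypothesis :=
  fejer_iff_riemannHypothesis_of_detection
    Summit.RiemannHypothesis.RiemannHypothesis.Theorems.combShapeDetection_proof

/-! ## H2 — the `S = ∅` face of the stub is the diagonal family -/

/-- For `S = ∅` (`N = 1`, divisors `{1}`, trivial character, lag `log 1 - log 1 = 0`) the Fejér cell IS `W(ψ_ε)`. -/
theorem fejer_cell_empty (ε : ℝ) (n : ℕ) (θ : ℕ → ℝ) :
    (∑ d ∈ (∏ p ∈ (∅ : Finset ℕ), p ^ n).divisors, ∑ d' ∈ (∏ p ∈ (∅ : Finset ℕ), p ^ n).divisors,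
        Complex.exp (I * ((∑ p ∈ (∅ : Finset ℕ), θ p * (d.factorization p : ℝ) : ℝ) : ℂ)) *
          conj (Complex.exp (I * ((∑ p ∈ (∅ : Finset ℕ), θ p * (d'.factorization p : ℝ) : ℝ) : ℂ))) *
          weilFunctional (weilTranslate
            (weilConv (fun t : ℝ => (ε : ℂ)⁻¹ * ((expNegInvGlue (1 - (t / ε) ^ 2) : ℝ) : ℂ))
              (weilReflect (fun t : ℝ => (ε : ℂ)⁻¹ * ((expNegInvGlue (1 - (t / ε) ^ 2) : ℝ) : ℂ))))
            (Real.log (d : ℝ) - Real.log (d' : ℝ)))) = diag ε := by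
  have hb : bump ε = fun t : ℝ => (ε : ℂ)⁻¹ * ((expNegInvGlue (1 - (t / ε) ^ 2) : ℝ) : ℂ) := rfl
  have e : diag ε = weilFunctional (weilTranslate (autocorr ε) 0) := by
    unfold diag; congr 1; funext t; simp [weilTranslate]
  rw [e]
  simp [autocorr, hb]

/-! ## H3 — the diagonal on the zero side, and its growth in `ε` -/

/-- H3a — dilation: `(φ_ε)^(s) = Φ₀(ε (s - 1/2))` (`weilMellin_comp_mul`). -/
theorem weilMellin_bump {ε : ℝ} (hε : 0 < ε) (s : ℂ) :
    weilMellin (bump ε) s = weilMellin (bump 1) (1 / 2 + ε * (s - 1 / 2)) := by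
  sorry

/-- H3b — zero side of the diagonal: `W(ψ_ε) = Σ_ρ m(ρ) Φ₀(ε(ρ - 1/2))²`
(`combShapeDetection_zeroForm_eq_weilQuadratic`, `weilMellin_weilQuadratic`; `φ₀` real and even turns
`ĝ(ρ) conj ĝ(1 - ρ̄)` into a SQUARE, not a modulus squared — the whole RH content). -/
theorem diag_eq_zeroSum {ε : ℝ} (hε : 0 < ε) :
    diag ε = ∑' ρ : ZetaZeros.riemannZetaNontrivialZeros,
      (riemannZetaZeroOrder (ρ : ℂ) : ℂ) * weilMellin (bump 1) (1 / 2 + ε * ((ρ : ℂ) - 1 / 2)) ^ 2 := by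
  sorry

/-- H3c — growth: `|W(ψ_ε)| ≤ C e^{ε}` for `ε ≥ 1` (`|Re ρ - 1/2| < 1/2`, two integrations by parts in
`Φ₀`, `Σ_ρ |Im ρ|⁻⁴ < ∞`); gives absolute convergence of the Laplace transform on `Re s > 1`. -/
theorem norm_diag_le : ∃ C : ℝ, ∀ ε : ℝ, 1 ≤ ε → ‖diag ε‖ ≤ C * Real.exp ε := by
  sorry

/-! ## H4–H6 — the one-zero kernel `T_w` (pure analysis, no zeta) -/

/-- `ψ₀ = φ₀ ⋆ φ₀` (smooth, even, `> 0` exactly on `(-2, 2)`). -/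
def bumpK (t : ℝ) : ℝ := ∫ u : ℝ, expNegInvGlue (1 - u ^ 2) * expNegInvGlue (1 - (t - u) ^ 2)

/-- `T_w(s) = ∫_{-2}^{2} ψ₀(t) e^{ε₀(wt - s)} / (s - wt) dt`: the Laplace transform (in the dilation
parameter, from `ε₀` on) of one zero's contribution `Φ₀(εw)²`, continued to `ℂ ∖ w·[-2,2]`. -/
def cauchyT (ε₀ : ℝ) (w s : ℂ) : ℂ :=
  ∫ t in (-2 : ℝ)..2, (bumpK t : ℂ) * cexp ((ε₀ : ℂ) * (w * t - s)) / (s - w * t)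

/-- H4a — `∫_{ε₀}^∞ Φ₀(εw)² e^{-sε} dε = T_w(s)` for `Re s > 2|Re w|` (`Φ₀(εw)² = ∫ ψ₀(t) e^{εwt} dt`, Fubini). -/
theorem laplace_sq_eq_cauchyT {ε₀ : ℝ} (hε₀ : 0 < ε₀) (w s : ℂ) (hs : 2 * |w.re| < s.re) :
    ∫ ε in Ioi ε₀, weilMellin (bump 1) (1 / 2 + ε * w) ^ 2 * cexp (-(s * ε)) = cauchyT ε₀ w s := by
  sorry

/-- H4b — `T_w` is holomorphic off the segment `w·[-2, 2]`. -/
theorem differentiableOn_cauchyT (ε₀ : ℝ) (w : ℂ) :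
    DifferentiableOn ℂ (cauchyT ε₀ w) {s : ℂ | ∀ t : ℝ, t ∈ Icc (-2 : ℝ) 2 → s ≠ w * t} := by
  sorry

/-- H5 — favourable-side bound: when the pole `s/w` lies on the far side of the real `t`-axis from the
oscillation `e^{i ε₀ (Im w) t}` (always the case near the positive real `s`-axis), the `η`-representation
`1/(s - wt) = (i/w) ∫_0^∞ e^{iη(t - s/w)} dη` and three integrations by parts give `O(|Im w|⁻³)`,
uniformly — summable over the zeros, so `Σ_ρ m(ρ) T_{ρ-1/2}` converges off finitely many segments locally. -/
theorem norm_cauchyT_le {ε₀ : ℝ} (hε₀ : 0 < ε₀) (R : ℝ) :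
    ∃ C : ℝ, ∀ w s : ℂ, |w.re| ≤ 1 / 2 → 1 ≤ |w.im| → 0 ≤ s.re → ‖s‖ ≤ R →
      (s * conj w).im * w.im < 0 → ‖cauchyT ε₀ w s‖ ≤ C / |w.im| ^ 3 := by
  sorry

/-- H6 — circle identity (Fubini + Cauchy's formula for the entire `e^{-ε₀ s}` at the simple pole `s = wt`):
the factor `e^{ε₀ w t}` cancels, so every zero on the segment's line contributes a POSITIVE `ψ₀`-mass. -/
theorem circleIntegral_cauchyT {ε₀ : ℝ} (hε₀ : 0 < ε₀) (w c : ℂ) {R : ℝ} (hR : 0 < R) :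
    (∮ z in C(c, R), cauchyT ε₀ w z) =
      2 * π * I * ∫ t in {t : ℝ | t ∈ Icc (-2 : ℝ) 2 ∧ ‖w * t - c‖ < R}, (bumpK t : ℂ) := by
  sorry

/-! ## H7 — dilation detection, and the minimal face of the stub -/

/-- **H7 — DILATION DETECTION.** Nonnegativity of the single diagonal entry `W(ψ_ε)` for all widths
`ε ≥ 1` already implies RH: Landau's lemma (`Landau.integrableOn_of_differentiableOn_union_convex`, tree) for
`x ↦ W(ψ_{log x})` pushes the abscissa to `0`; the continuation `Σ_ρ m(ρ) T_{ρ-1/2}` is holomorphic on the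
right half-plane minus the (locally finitely many) segments `(ρ-1/2)·(0,2]` of off-line zeros and equals the
transform there; H6 around an interior point of the segment of an off-line zero gives `∮ ≠ 0`, against
Cauchy's theorem for the transform. -/
theorem riemannHypothesis_of_diag_nonneg (h : ∀ ε : ℝ, 1 ≤ ε → 0 ≤ (diag ε).re) :
    RiemannHypothesis := by
  sorry

/-- H8 — the diagonal family is an RH-equivalent: the stub (all `S, n, θ`) is equivalent to its `S = ∅`
face, the crux to its `M = 1` cells; "induction on `|S|`" has an RH-complete base case. -/
theorem diag_nonneg_iff_riemannHypothesis :
    (∀ ε : ℝ, 0 < ε → 0 ≤ (diag ε).re) ↔ RiemannHypothesis := by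
  refine ⟨fun h => riemannHypothesis_of_diag_nonneg fun ε hε => h ε (by linarith), fun hRH ε hε => ?_⟩
  have h := fejer_of_riemannHypothesis hRH ε hε ∅ (by simp) 0 (fun _ => 0)
  rwa [fejer_cell_empty] at h

end Summit.RiemannHypothesis.RiemannHypothesis.Theorems.WeilCombBohrFejer.StubFejerIdeas1

end
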